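import Literature.MathematicalPhysics.QuantumFieldTheory.Balaban1983to89.B9Thm311SmallFieldClosed

/-!
# `Balaban1983to89.B9Eq368RLipschitz` — T. Bałaban, *Propagators for lattice gauge theories in a background field*, Commun. Math. Phys. **99** (1985)
# 389–434 [Balaban1985BackgroundPropagators] (3.68) p. 403 / (3.76)–(3.77) p. 406 with Thm 3.4 p. 400: AT A FIXED LATTICE THE pub-balaban NE9 CHAIN'S
# PROJECTION `R(U)` ONTO `Δ_U N(Q′(U))` ((3.21)) IS LIPSCHITZ IN THE BACKGROUND AT THE FLAT POINT — `‖R(U)z − R(1)z‖ ≤ C_R·ε·‖z‖` for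
# `‖U(b) − 1‖ ≤ ε ≤ ε_R`: the `R`-remainder of `B9Eq368ProjectionRemainder` (gap of subspaces) with the `Δ^η_U`-remainder of
# `B9Eq373DerivativeRemainderL2`, the flat modulus of `B9Eq323FlatBlockPoincare` and the `Q′`-letter of NE9 leaf-03's `B9Eq319QprimeLipschitz`, LINEAR in `ε`

statement-level skeleton of published theorems with citation tags; proofs where landed; nothing here is a claim about the Yang–Mills mass gap

PDF held: `paper:balaban1985-cmp99-background-propagators` (journal page = PDF page + 388), pp. 400, 403, 406 read by this seat (2026-08-22).

THE PRINT (first-hand, text layer).  p. 403: *«the operators R(U), P(U) = I − R(U) extend … and satisfy the same bounds»*; pp. 405–406, (3.76), last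
member: *«= DRD* − V₂(A) − P₁(A). (3.76)»* (the expansion of `D_{U′U}R(U′U)D*_{U′U}` around `DRD*`); p. 407: *«The operator P₁(A) was defined in
(3.76). It is a non-local bounded operator and satisfies the bound (3.77)»* ((3.77) p. 406 is a KERNEL decay bound of size O(1)α₁(L^jη)⁻²(L^{j′}η)^{−d}
e^{−½δ₀d(y,y′)}); p. 400, Thm 3.4: *«small perturbations of the operators depending on U only»*.  NOTE: the v1 header's line «R(U′U) = R(U) + P₁(A) …
|P₁(A)| ≤ O(1)α₁» was a PARAPHRASE (R's perturbation enters (3.76) through P₁(A)), not a display of the paper (readers ne9-leaf-02 g57 R-1, ne9-leaf-05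
g68 X1); this DOCFIX (gen 81) replaces it; statement and proof byte-identical.

WHY THIS FILE (cell context).  The `𝔊 = G₁𝔓*`-letter of the chain ((3.153), `B11Eq103H1Complex.frakGLatticeK`) contains `R(U)`; its continuity in
the background (`B9Eq3153FrakGLipschitz`, via the telescoping `B9Eq386ResolventLetters.norm_frakG_formula_sub_le`) needs the `R`-letter's Lipschitz
bound IN ISOLATION.  `B9Thm311SmallFieldCoercivity` §5 bounded `R(U) − R(1)` inside the assembly of (3.82) (the `hRdiff` step) with a non-linear
constant; this file repeats that step with the averaging letter `ρ′` of NE9 leaf-03 inserted and the constant bounded LINEARLY in `ε`.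

WHAT IS PROVED (sorry-free; no `Prop` placeholder; no inequality of the paper asserted).
* **`exists_RofU_sub_flat_linear`** — `∃ C_R ε_R > 0` such that for every background `U` on the torus with `U(b) ∈ U1`, `‖U(b) − 1‖ ≤ ε ≤ ε_R` and
  mutually adjoint transporters (`hRS`): `‖R(U)z − R(1)z‖ ≤ C_R·ε·‖z‖` for the chain's `RofU` (print's `P₁(A)` of (3.76), first order at `A = 0`).
MODEL / HONEST SCOPE.  [folklore] finite-dimensional bookkeeping at a FIXED lattice (`C_R, ε_R` depend on `L, m, η, c₀, M_φ, M_φ′`); at the flat point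
only; NOT print's analytic `P₁(A)`, NOT uniformity; NOT summit progress (cell pub-balaban: NE9 NOT PRINTED / NOT PROVED; spine PROVED 0/9).  Filed by the
pub-balaban NE9 BINDER-row owner lineage `b2b-balaban-t4-ne9-p1` (gen 81); NEW file importing `B9Thm311SmallFieldClosed` only; nothing modified.
Net new unproved facts: 0.
-/

noncomputable section

open scoped InnerProductSpace ComplexConjugate

namespace Literature.MathematicalPhysics.QuantumFieldTheory.Balaban1983to89.B9Eq368RLipschitz

open B4Sect5Torus (TSite)
open B9SectCLatticeCarrier (Bond)
open B7Prop1Explicit (U1)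
open B9Eq311L2Pairing (WL2)
open B9Eq319QprimeTorus (fineP centre weight)
open B9Eq319Onto (centreFun)
open B11Eq103H1Complex (SiteL2K BondL2K covLaplaceSiteK RLatticeK)
open B9Eq310HessianOperator (adTransportW)
open B9Eq326OperatorAssembly (RofU QprimeW)
open B9Eq368ProjectionRemainder (norm_projR_sub_projR_le)
open B9Eq373DerivativeRemainderL2 (norm_covLaplaceSiteK_sub_le norm_covLaplaceSiteK_le)
open B9Eq384RemainderLetters (adTransportW_one_apply adTransportW_one_inv_apply hRS_one centreFun_add centreFun_smul QprimeW_centre norm_centre_le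
  norm_adTransportW_sub_le)
open B9Eq323FlatBlockPoincare (exists_flat_modulus_explicit)
open B9Eq319QprimeLipschitz (norm_QprimeW_sub_flat_le_L2 rho_le)

/-- arithmetic helper: `B·t ≤ μ/2` when `t ≤ μ/(2B + 1)`. [folklore] -/
private theorem mul_le_half_of_le_div {B μ t : ℝ} (hB : 0 ≤ B) (hμ : 0 ≤ μ) (ht : t ≤ μ / (2 * B + 1)) : B * t ≤ μ / 2 := by
  have h1 : B * t ≤ B * (μ / (2 * B + 1)) := mul_le_mul_of_nonneg_left ht hB
  have h2 : B * (μ / (2 * B + 1)) ≤ μ / 2 := by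
    rw [mul_div_assoc', div_le_div_iff₀ (by positivity) (by norm_num)]; nlinarith
  exact h1.trans h2

variable {d : ℕ} (L : ℕ) [NeZero L] (m : Fin d → ℕ) [∀ i, NeZero (fineP L m i)]
  {𝔸 : Type*} [NormedRing 𝔸] [NormedAlgebra ℂ 𝔸] [NormOneClass 𝔸]
  {W : Type*} [NormedAddCommGroup W] [InnerProductSpace ℂ W] [FiniteDimensional ℂ W] (φ : W ≃ₗ[ℂ] 𝔸) {c₀ : ℝ} [Fact (0 < c₀)]
set_option maxHeartbeats 400000 in
/-- **`R(U)` IS LIPSCHITZ IN THE BACKGROUND AT THE FLAT POINT**: `∃ C_R ε_R > 0` such that for every `U` with `U(b) ∈ U1`, `‖U(b) − 1‖ ≤ ε ≤ ε_R` and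
`hRS`: `‖R(U)z − R(1)z‖ ≤ C_R·ε·‖z‖` — the gap-of-subspaces remainder of `B9Eq368ProjectionRemainder.norm_projR_sub_projR_le` at `Δ_i := Δ^η`
(`covLaplaceSiteK`, remainder `εΔ = 2(2+εR)|η|⁻²d·εR`, `εR = 2M_φM_φ′ε`), `Q′_i := Q′` with the common centre right inverse (ρ by NE9 leaf-03's letter and
the centre lift's norm), flat modulus `μ`; the constant made linear by `ε ≤ ε_R`. [cite: Balaban1985BackgroundPropagators, (3.68) p.403, (3.76)–(3.77) p.406, (3.21) p.394] -/
theorem exists_RofU_sub_flat_linear {η : ℝ} (hη : η ≠ 0) {Mφ Mφ' : ℝ} (hMφ : 0 ≤ Mφ) (hMφ' : 0 ≤ Mφ')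
    (hφ : ∀ w, ‖φ w‖ ≤ Mφ * ‖w‖) (hφ' : ∀ X, ‖φ.symm X‖ ≤ Mφ' * ‖X‖) :
    ∃ CR εR₀ : ℝ, 0 < CR ∧ 0 < εR₀ ∧ ∀ (U : Bond d (fineP L m) → 𝔸ˣ) {ε : ℝ}, 0 ≤ ε → ε ≤ εR₀ →
      (∀ b, U b ∈ U1 𝔸) → (∀ b, ‖(U b : 𝔸) - 1‖ ≤ ε) →
      (∀ (b : Bond d (fineP L m)) (v u : W), ⟪adTransportW φ U b v, u⟫_ℂ = ⟪v, adTransportW φ (fun b => (U b)⁻¹) b u⟫_ℂ) →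
      ∀ z : SiteL2K ℂ d (fineP L m) c₀ W,
        ‖RofU L m φ η U z - RofU L m φ η (fun _ : Bond d (fineP L m) => (1 : 𝔸ˣ)) z‖ ≤ CR * ε * ‖z‖ := by
  have hc₀ : 0 < c₀ := Fact.out
  have hc : conj ((η : ℂ))⁻¹ = ((η : ℂ))⁻¹ := by rw [map_inv₀, Complex.conj_ofReal]
  obtain ⟨μ, hμ, hmod⟩ := exists_flat_modulus_explicit L m φ (c₀ := c₀) hη
  -- constants
  obtain ⟨KR, hKRdef⟩ : ∃ KR : ℝ, KR = 2 * Mφ * Mφ' := ⟨_, rfl⟩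
  have hKR : 0 ≤ KR := by rw [hKRdef]; positivity
  obtain ⟨Cρ, hCρdef⟩ : ∃ Cρ : ℝ, Cρ = (d * (L - 1) : ℕ) * 2 ^ (d * (L - 1)) * (Real.sqrt c₀)⁻¹ := ⟨_, rfl⟩
  have hCρ : 0 ≤ Cρ := by rw [hCρdef]; positivity
  obtain ⟨CS, hCSdef⟩ : ∃ CS : ℝ, CS = (L : ℝ) ^ d * Real.sqrt (c₀ * Fintype.card (TSite d (fineP L m))) := ⟨_, rfl⟩
  have hCS : 0 ≤ CS := by rw [hCSdef]; positivity
  -- `t := (1 + Cρ·KR)·ε` dominates `ε` and `ρ′ = Cρ·KR·ε`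
  obtain ⟨B, hBdef⟩ : ∃ B : ℝ, B = μ * CS + 6 * ‖((η : ℂ))⁻¹‖ ^ 2 * d * KR + 16 * ‖((η : ℂ))⁻¹‖ ^ 2 * d * CS := ⟨_, rfl⟩
  have hB : 0 ≤ B := by rw [hBdef]; positivity
  obtain ⟨CR, hCRdef⟩ : ∃ CR : ℝ, CR = 4 * (6 * ‖((η : ℂ))⁻¹‖ ^ 2 * d * KR + 16 * ‖((η : ℂ))⁻¹‖ ^ 2 * d * CS) / μ * (1 + Cρ * KR) + 1 := ⟨_, rfl⟩
  have hCR : 0 < CR := by rw [hCRdef]; positivity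
  refine ⟨CR, min (1 / (KR + 1)) (μ / (2 * B + 1) / (1 + Cρ * KR)), hCR, by positivity, ?_⟩
  intro U ε hε hεR₀ hUb hUε hRS z
  have ht1 : ε ≤ 1 / (KR + 1) := hεR₀.trans (min_le_left _ _)
  have ht2' : ε ≤ μ / (2 * B + 1) / (1 + Cρ * KR) := hεR₀.trans (min_le_right _ _)
  have ht2 : (1 + Cρ * KR) * ε ≤ μ / (2 * B + 1) := by
    have := mul_le_mul_of_nonneg_left ht2' (by positivity : (0 : ℝ) ≤ 1 + Cρ * KR)
    rwa [mul_div_cancel₀ _ (by positivity : (1 + Cρ * KR) ≠ 0)] at this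
  -- the transporters
  obtain ⟨εR, hεRdef⟩ : ∃ εR : ℝ, εR = KR * ε := ⟨_, rfl⟩
  have hεR : 0 ≤ εR := by rw [hεRdef]; positivity
  have hεR1 : εR ≤ 1 := by
    rw [hεRdef]
    refine (mul_le_mul_of_nonneg_left ht1 hKR).trans ?_
    rw [mul_one_div, div_le_one (by positivity)]; linarith
  have hR : ∀ (b : Bond d (fineP L m)) (w : W), ‖adTransportW φ U b w - w‖ ≤ εR * ‖w‖ := fun b w => by
    have h := norm_adTransportW_sub_le φ hφ hφ' hMφ' U b (hUb b) (hUε b) w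
    rw [hεRdef, hKRdef]; linarith
  have hR₁ : ∀ (b : Bond d (fineP L m)) (w : W), adTransportW φ (fun _ : Bond d (fineP L m) => (1 : 𝔸ˣ)) b w = w :=
    adTransportW_one_apply L m φ
  have hS₁ : ∀ (b : Bond d (fineP L m)) (w : W), adTransportW φ (fun _ : Bond d (fineP L m) => (1 : 𝔸ˣ)⁻¹) b w = w :=
    adTransportW_one_inv_apply L m φ
  have hR₁ε : ∀ (b : Bond d (fineP L m)) (w : W), ‖adTransportW φ (fun _ : Bond d (fineP L m) => (1 : 𝔸ˣ)) b w - w‖ ≤ εR * ‖w‖ :=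
    fun b w => by rw [hR₁, sub_self, norm_zero]; positivity
  have hRS₁ := hRS_one L m φ (𝔸 := 𝔸)
  -- (ρ′) by NE9 leaf-03, then the centre lift: `ρ = CS·Cρ·εR`
  have hρ' : (1 + KR * ε) ^ (d * (L - 1)) - 1 ≤ Cρ * Real.sqrt c₀ * (KR * ε) := by
    have h := rho_le L (d := d) (show 0 ≤ KR * ε by positivity)
    have hKε1 : KR * ε ≤ 1 := by rw [← hεRdef]; exact hεR1
    have h2 : (1 + KR * ε) ^ (d * (L - 1)) ≤ 2 ^ (d * (L - 1)) := pow_le_pow_left₀ (by positivity) (by linarith) _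
    have hs : Cρ * Real.sqrt c₀ = (d * (L - 1) : ℕ) * 2 ^ (d * (L - 1)) := by
      rw [hCρdef, mul_assoc, inv_mul_cancel₀ (Real.sqrt_pos.2 hc₀).ne', mul_one]
    rw [hs]
    calc (1 + KR * ε) ^ (d * (L - 1)) - 1 ≤ (d * (L - 1) : ℕ) * (KR * ε) * (1 + KR * ε) ^ (d * (L - 1)) := h
      _ ≤ (d * (L - 1) : ℕ) * (KR * ε) * 2 ^ (d * (L - 1)) := mul_le_mul_of_nonneg_left h2 (by positivity)
      _ = (d * (L - 1) : ℕ) * 2 ^ (d * (L - 1)) * (KR * ε) := by ring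
  have hQ' : ∀ l : SiteL2K ℂ d (fineP L m) c₀ W,
      ‖QprimeW L m φ U l - QprimeW L m φ (fun _ : Bond d (fineP L m) => (1 : 𝔸ˣ)) l‖ ≤ Cρ * (KR * ε) * ‖l‖ := fun l => by
    refine (norm_QprimeW_sub_flat_le_L2 L m φ U (show 0 ≤ KR * ε by positivity) (by rw [← hεRdef]; exact hR) l).trans ?_
    rw [← mul_assoc]
    refine mul_le_mul_of_nonneg_right ?_ (norm_nonneg _)
    have hs0 : 0 < Real.sqrt c₀ := Real.sqrt_pos.2 hc₀
    calc ((1 + KR * ε) ^ (d * (L - 1)) - 1) * (Real.sqrt c₀)⁻¹ ≤ (Cρ * Real.sqrt c₀ * (KR * ε)) * (Real.sqrt c₀)⁻¹ :=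
          mul_le_mul_of_nonneg_right hρ' (by positivity)
      _ = Cρ * (KR * ε) := by field_simp
  obtain ⟨ρ, hρdef⟩ : ∃ ρ : ℝ, ρ = CS * (Cρ * (KR * ε)) := ⟨_, rfl⟩
  have hρ0 : 0 ≤ ρ := by rw [hρdef]; positivity
  -- the centre lift as a linear map
  let S₀ : (TSite d m → W) →ₗ[ℂ] SiteL2K ℂ d (fineP L m) c₀ W :=
    { toFun := fun ω => (WL2.equiv ℂ (fun _ : TSite d (fineP L m) => c₀) W).symm (centreFun (weight L m) (centre L m) ω)
      map_add' := fun ω ω' => by rw [centreFun_add]; rfl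
      map_smul' := fun r ω => by rw [centreFun_smul]; rfl }
  have hS₀ : ∀ (V : Bond d (fineP L m) → 𝔸ˣ) (f : TSite d m → W), QprimeW L m φ V (c₀ := c₀) (S₀ f) = f :=
    fun V f => QprimeW_centre L m φ V f
  have hρ : ∀ l : SiteL2K ℂ d (fineP L m) c₀ W,
      ‖S₀ (QprimeW L m φ U l - QprimeW L m φ (fun _ : Bond d (fineP L m) => (1 : 𝔸ˣ)) l)‖ ≤ ρ * ‖l‖ := fun l =>
    (norm_centre_le L m _).trans (by
      rw [← hCSdef]
      calc CS * ‖QprimeW L m φ U l - QprimeW L m φ (fun _ : Bond d (fineP L m) => (1 : 𝔸ˣ)) l‖ ≤ CS * (Cρ * (KR * ε) * ‖l‖) :=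
            mul_le_mul_of_nonneg_left (hQ' l) hCS
        _ = ρ * ‖l‖ := by rw [hρdef]; ring)
  -- smallness bookkeeping against `t = (1 + CρKR)·ε`
  have hεt : ε ≤ (1 + Cρ * KR) * ε := by nlinarith
  have hεRt : εR ≤ KR * ((1 + Cρ * KR) * ε) := by rw [hεRdef]; exact mul_le_mul_of_nonneg_left hεt hKR
  have hρt : ρ ≤ CS * ((1 + Cρ * KR) * ε) := by
    rw [hρdef]; refine mul_le_mul_of_nonneg_left ?_ hCS; nlinarith
  have hεΔ : 2 * (2 + εR) * ‖((η : ℂ))⁻¹‖ ^ 2 * d * εR ≤ 6 * ‖((η : ℂ))⁻¹‖ ^ 2 * d * KR * ((1 + Cρ * KR) * ε) := by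
    have h1 : 2 * (2 + εR) ≤ 6 := by linarith
    calc 2 * (2 + εR) * ‖((η : ℂ))⁻¹‖ ^ 2 * d * εR = (2 * (2 + εR)) * (‖((η : ℂ))⁻¹‖ ^ 2 * d * εR) := by ring
      _ ≤ 6 * (‖((η : ℂ))⁻¹‖ ^ 2 * d * (KR * ((1 + Cρ * KR) * ε))) :=
          mul_le_mul h1 (mul_le_mul_of_nonneg_left hεRt (by positivity)) (by positivity) (by norm_num)
      _ = 6 * ‖((η : ℂ))⁻¹‖ ^ 2 * d * KR * ((1 + Cρ * KR) * ε) := by ring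
  have hM16 : 4 * (1 + εR) ^ 2 * ‖((η : ℂ))⁻¹‖ ^ 2 * d ≤ 16 * ‖((η : ℂ))⁻¹‖ ^ 2 * d := by
    have h1 : (1 + εR) ^ 2 ≤ 4 := by
      calc (1 + εR) ^ 2 ≤ 2 ^ 2 := pow_le_pow_left₀ (by positivity) (by linarith) 2
        _ = 4 := by norm_num
    calc 4 * (1 + εR) ^ 2 * ‖((η : ℂ))⁻¹‖ ^ 2 * d = (1 + εR) ^ 2 * (4 * ‖((η : ℂ))⁻¹‖ ^ 2 * d) := by ring
      _ ≤ 4 * (4 * ‖((η : ℂ))⁻¹‖ ^ 2 * d) := mul_le_mul_of_nonneg_right h1 (by positivity)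
      _ = 16 * ‖((η : ℂ))⁻¹‖ ^ 2 * d := by ring
  have hMρ : 4 * (1 + εR) ^ 2 * ‖((η : ℂ))⁻¹‖ ^ 2 * d * ρ ≤ 16 * ‖((η : ℂ))⁻¹‖ ^ 2 * d * CS * ((1 + Cρ * KR) * ε) :=
    calc 4 * (1 + εR) ^ 2 * ‖((η : ℂ))⁻¹‖ ^ 2 * d * ρ ≤ 16 * ‖((η : ℂ))⁻¹‖ ^ 2 * d * ρ := mul_le_mul_of_nonneg_right hM16 hρ0
      _ ≤ 16 * ‖((η : ℂ))⁻¹‖ ^ 2 * d * (CS * ((1 + Cρ * KR) * ε)) := mul_le_mul_of_nonneg_left hρt (by positivity)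
      _ = 16 * ‖((η : ℂ))⁻¹‖ ^ 2 * d * CS * ((1 + Cρ * KR) * ε) := by ring
  have hμρ : μ * ρ ≤ μ * CS * ((1 + Cρ * KR) * ε) := by rw [mul_assoc]; exact mul_le_mul_of_nonneg_left hρt hμ.le
  have hBt : B * ((1 + Cρ * KR) * ε) ≤ μ / 2 := mul_le_half_of_le_div hB hμ.le ht2
  have hsum : μ * ρ + (2 * (2 + εR) * ‖((η : ℂ))⁻¹‖ ^ 2 * d * εR + 4 * (1 + εR) ^ 2 * ‖((η : ℂ))⁻¹‖ ^ 2 * d * ρ) ≤ μ / 2 := by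
    have : μ * CS * ((1 + Cρ * KR) * ε) + (6 * ‖((η : ℂ))⁻¹‖ ^ 2 * d * KR * ((1 + Cρ * KR) * ε) +
        16 * ‖((η : ℂ))⁻¹‖ ^ 2 * d * CS * ((1 + Cρ * KR) * ε)) = B * ((1 + Cρ * KR) * ε) := by rw [hBdef]; ring
    linarith [hμρ, hεΔ, hMρ]
  have hrew : μ * (1 - ρ) - (2 * (2 + εR) * ‖((η : ℂ))⁻¹‖ ^ 2 * d * εR + 4 * (1 + εR) ^ 2 * ‖((η : ℂ))⁻¹‖ ^ 2 * d * ρ) =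
      μ - (μ * ρ + (2 * (2 + εR) * ‖((η : ℂ))⁻¹‖ ^ 2 * d * εR + 4 * (1 + εR) ^ 2 * ‖((η : ℂ))⁻¹‖ ^ 2 * d * ρ)) := by ring
  have hν2 : μ / 2 ≤ μ * (1 - ρ) - (2 * (2 + εR) * ‖((η : ℂ))⁻¹‖ ^ 2 * d * εR + 4 * (1 + εR) ^ 2 * ‖((η : ℂ))⁻¹‖ ^ 2 * d * ρ) := by
    rw [hrew]; linarith
  have hν : 0 < μ * (1 - ρ) - (2 * (2 + εR) * ‖((η : ℂ))⁻¹‖ ^ 2 * d * εR + 4 * (1 + εR) ^ 2 * ‖((η : ℂ))⁻¹‖ ^ 2 * d * ρ) :=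
    lt_of_lt_of_le (by positivity) hν2
  -- the gap-of-subspaces remainder
  have hM : 0 ≤ 4 * (1 + εR) ^ 2 * ‖((η : ℂ))⁻¹‖ ^ 2 * d := by positivity
  have hεp : 0 ≤ 2 * (2 + εR) * ‖((η : ℂ))⁻¹‖ ^ 2 * d * εR := by positivity
  have hRdiff : ‖RofU L m φ η U z - RofU L m φ η (fun _ => 1) z‖ ≤
      2 * (2 * (2 + εR) * ‖((η : ℂ))⁻¹‖ ^ 2 * d * εR + 4 * (1 + εR) ^ 2 * ‖((η : ℂ))⁻¹‖ ^ 2 * d * ρ) /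
        (μ * (1 - ρ) - (2 * (2 + εR) * ‖((η : ℂ))⁻¹‖ ^ 2 * d * εR + 4 * (1 + εR) ^ 2 * ‖((η : ℂ))⁻¹‖ ^ 2 * d * ρ)) * ‖z‖ := by
    rw [norm_sub_rev]
    unfold RofU RLatticeK
    exact norm_projR_sub_projR_le _ _ _ _ S₀ S₀ (hS₀ _) (hS₀ _) hμ hM hεp hρ0 hmod
      (norm_covLaplaceSiteK_le _ hc hεR hR₁ε hRS₁) (norm_covLaplaceSiteK_le _ hc hεR hR hRS)
      (norm_covLaplaceSiteK_sub_le _ hc hεR hR hR₁ hRS hS₁) hρ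
      (fun l => by
        have h : S₀ (QprimeW L m φ (fun _ : Bond d (fineP L m) => (1 : 𝔸ˣ)) l - QprimeW L m φ U l) =
            -S₀ (QprimeW L m φ U l - QprimeW L m φ (fun _ : Bond d (fineP L m) => (1 : 𝔸ˣ)) l) := by
          rw [← map_neg, neg_sub]
        rw [h, norm_neg]; exact hρ l)
      hν z
  -- the constant, linear in `ε`
  have hδR : 2 * (2 * (2 + εR) * ‖((η : ℂ))⁻¹‖ ^ 2 * d * εR + 4 * (1 + εR) ^ 2 * ‖((η : ℂ))⁻¹‖ ^ 2 * d * ρ) /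
      (μ * (1 - ρ) - (2 * (2 + εR) * ‖((η : ℂ))⁻¹‖ ^ 2 * d * εR + 4 * (1 + εR) ^ 2 * ‖((η : ℂ))⁻¹‖ ^ 2 * d * ρ)) ≤
      4 * (6 * ‖((η : ℂ))⁻¹‖ ^ 2 * d * KR + 16 * ‖((η : ℂ))⁻¹‖ ^ 2 * d * CS) * ((1 + Cρ * KR) * ε) / μ := by
    have hnum : 0 ≤ 2 * (2 * (2 + εR) * ‖((η : ℂ))⁻¹‖ ^ 2 * d * εR + 4 * (1 + εR) ^ 2 * ‖((η : ℂ))⁻¹‖ ^ 2 * d * ρ) := by positivity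
    calc _ ≤ 2 * (2 * (2 + εR) * ‖((η : ℂ))⁻¹‖ ^ 2 * d * εR + 4 * (1 + εR) ^ 2 * ‖((η : ℂ))⁻¹‖ ^ 2 * d * ρ) / (μ / 2) :=
          div_le_div_of_nonneg_left hnum (by positivity) hν2
      _ = 4 * (2 * (2 + εR) * ‖((η : ℂ))⁻¹‖ ^ 2 * d * εR + 4 * (1 + εR) ^ 2 * ‖((η : ℂ))⁻¹‖ ^ 2 * d * ρ) / μ := by
          field_simp; ring
      _ ≤ 4 * (6 * ‖((η : ℂ))⁻¹‖ ^ 2 * d * KR * ((1 + Cρ * KR) * ε) + 16 * ‖((η : ℂ))⁻¹‖ ^ 2 * d * CS * ((1 + Cρ * KR) * ε)) / μ := by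
          gcongr
      _ = 4 * (6 * ‖((η : ℂ))⁻¹‖ ^ 2 * d * KR + 16 * ‖((η : ℂ))⁻¹‖ ^ 2 * d * CS) * ((1 + Cρ * KR) * ε) / μ := by ring
  refine hRdiff.trans (mul_le_mul_of_nonneg_right (hδR.trans ?_) (norm_nonneg _))
  have hslack : 0 ≤ 1 * ε := by positivity
  have hring : 4 * (6 * ‖((η : ℂ))⁻¹‖ ^ 2 * d * KR + 16 * ‖((η : ℂ))⁻¹‖ ^ 2 * d * CS) * ((1 + Cρ * KR) * ε) / μ + 1 * ε = CR * ε := by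
    rw [hCRdef]; ring
  exact (le_add_of_nonneg_right hslack).trans hring.le

end Literature.MathematicalPhysics.QuantumFieldTheory.Balaban1983to89.B9Eq368RLipschitz

end
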